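import Mathlib
import Summits.ABC.ABC.Theses.IneffectiveSubspace
import Summits.ABC.ABC.Theorems.TowerFourSubLiouville.Negative.Framing

/-!
# Stub `stub_transfer` of line `fourth-radical-binomial-thue` — crux `IneffectiveSubspace.TowerFourSubLiouville` (stmt-ABC-1649)

THE TRANSFER `C⁺ ⟹ crux`: a uniform power saving `η > 0` over Liouville's `|wZ⁴ − vY⁴| ≥ 1` for the
binomial quartic family (`|wZ⁴ − vY⁴| > Z^η` whenever `v, w, Y > 0`, `gcd(vY, wZ) = 1`,
`max(v, w) ≤ Z^η`, `wZ⁴ ≠ vY⁴`, `Z ≥ Z₀`) implies `∃ A < 2, TowerIneq(4, A)`, namely with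
`A = 4/(2 + θ)`, `θ = η/(24 + 6η)` (and a constant `C` that does not even depend on `ε`).

Proof. Write `a = ∏ xᵢ^{i+1}`, `b`, `c` likewise, `Π = ∏ xᵢyᵢzᵢ`, `E = (x₀y₀z₀)³(x₁y₁z₁)²(x₂y₂z₂)`.
Fix `s ≥ A` and call a positive coprime point a *violator* if `Π^s ≤ c`.  For a violator with
`a ≤ b`, `Negative.bad_point_shape` (constant `1`) gives `a·E·c² ≤ 2c^{4/s}`, i.e.
`a·E ≤ 2c^{4/s−2} ≤ 2c^θ` (`4/s − 2 ≤ 4/A − 2 = θ`, `c ≥ 1`).  Expanding the `Fin 4` products,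
`b = vY⁴`, `c = wZ⁴` with `v = y₀y₁²y₂³ ≤ E³`, `w = z₀z₁²z₂³ ≤ E³`, `Y = y₃`, `Z = z₃`; hence
`max(a, v, w) ≤ B := 8c^{3θ}`, and `B^{4/η+1} = 8^{4/η+1}·√c` because `3θ(4/η + 1) = 1/2`.
Put `K = 8^{4/η+1} + 8Z₀⁴`.  If `c ≥ K²` then `K√c ≤ c = wZ⁴ ≤ B·Z⁴ ≤ 8√c·Z⁴`, which forces
`Z ≥ Z₀` and `B^{4/η}·B ≤ B·Z⁴`, i.e. `B ≤ Z^η`; so `gcd(vY, wZ) = 1` (from `gcd(b, c) = 1`),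
`max(v, w) ≤ Z^η`, `wZ⁴ − vY⁴ = a ≠ 0`, and the saving yields `Z^η < a ≤ B ≤ Z^η` — absurd.
Therefore every violator has `c < K²` (the case `b ≤ a` is the same with `x ↔ y`), and
`C = K² + 1` works: `c < Π^s ≤ C·Π^s` for non-violators, `c < K² ≤ K²·Π^s < C·Π^s` for violators
(`Π ≥ 1`).
-/

set_option linter.dupNamespace false

namespace Summit.ABC.ABC.Theorems.TowerFourSubLiouville

open scoped BigOperators
open Summit.ABC.ABC.Theses.IneffectiveSubspace

/-- **Algebraic core of the transfer.** Under the saving `η` beyond `Z₀`: if `a + b = c` with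
`gcd(a, b) = 1`, `a ≥ 1`, `b = vY⁴`, `c = wZ⁴`, `v, w ≤ E³`, and the bad-point inequality
`a·E·c² ≤ 2c^{4/s}` holds for some `s ≥ 4/(2 + η/(24+6η))`, then `c < (8^{4/η+1} + 8Z₀⁴)²`. -/
theorem stubTransfer_core {η : ℝ} (hη : 0 < η) {Z₀ : ℕ}
    (hU : ∀ v w Y Z : ℕ, Z₀ ≤ Z → 0 < v → 0 < w → 0 < Y → Nat.Coprime (v * Y) (w * Z) →
      ((max v w : ℕ) : ℝ) ≤ (Z : ℝ) ^ η → w * Z ^ 4 ≠ v * Y ^ 4 →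
      (Z : ℝ) ^ η < |((w * Z ^ 4 : ℕ) : ℝ) - ((v * Y ^ 4 : ℕ) : ℝ)|)
    {s : ℝ} (hs : 4 / (2 + η / (24 + 6 * η)) ≤ s) {a b c E v w Y Z : ℕ}
    (ha0 : 0 < a) (heq : a + b = c) (hcop : Nat.Coprime a b)
    (hb : b = v * Y ^ 4) (hc : c = w * Z ^ 4) (hv0 : 0 < v) (hw0 : 0 < w) (hY0 : 0 < Y)
    (hE0 : 0 < E) (hvE : v ≤ E ^ 3) (hwE : w ≤ E ^ 3)
    (hshape : (a : ℝ) * (E : ℝ) * (c : ℝ) ^ 2 ≤ 2 * (c : ℝ) ^ (4 / s)) :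
    (c : ℝ) < ((8 : ℝ) ^ (4 / η + 1) + 8 * (Z₀ : ℝ) ^ 4) ^ 2 := by
  have hη' : η ≠ 0 := hη.ne'
  have h24 : (24 + 6 * η : ℝ) ≠ 0 := by positivity
  -- the constants `θ = η/(24+6η)` and `A = 4/(2+θ)`
  set θ : ℝ := η / (24 + 6 * η) with hθ
  have hθ0 : 0 < θ := by rw [hθ]; positivity
  have h2θ : (0 : ℝ) < 2 + θ := by linarith
  have hA0 : (0 : ℝ) < 4 / (2 + θ) := by positivity
  have hs0 : 0 < s := lt_of_lt_of_le hA0 hs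
  -- sizes
  have hc1 : (1 : ℝ) ≤ c := by exact_mod_cast (show 1 ≤ c by omega)
  have hc0 : (0 : ℝ) < c := by linarith
  have ha1 : (1 : ℝ) ≤ a := by exact_mod_cast ha0
  have hE1 : (1 : ℝ) ≤ E := by exact_mod_cast hE0
  -- `4/s - 2 ≤ θ`
  have hexp : 4 / s - 2 ≤ θ := by
    have h1 : (2 + θ) * (4 / (2 + θ)) = 4 := by field_simp
    have h2 : (2 + θ) * (4 / (2 + θ)) ≤ (2 + θ) * s := mul_le_mul_of_nonneg_left hs h2θ.le
    have h3 : 4 / s ≤ 2 + θ := by rw [div_le_iff₀ hs0]; linarith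
    linarith
  -- `a·E ≤ 2 c^θ`
  have haE : (a : ℝ) * E ≤ 2 * (c : ℝ) ^ θ := by
    have h1 : (c : ℝ) ^ (4 / s) = (c : ℝ) ^ (4 / s - 2) * (c : ℝ) ^ 2 := by
      rw [← Real.rpow_two, ← Real.rpow_add hc0]; congr 1; ring
    have h2 : (a : ℝ) * E * (c : ℝ) ^ 2 ≤ 2 * (c : ℝ) ^ (4 / s - 2) * (c : ℝ) ^ 2 := by
      rw [mul_assoc 2, ← h1]; exact hshape
    have h3 : (a : ℝ) * E ≤ 2 * (c : ℝ) ^ (4 / s - 2) := le_of_mul_le_mul_right h2 (by positivity)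
    have h4 : (c : ℝ) ^ (4 / s - 2) ≤ (c : ℝ) ^ θ := Real.rpow_le_rpow_of_exponent_le hc1 hexp
    linarith
  have hcθ0 : (0 : ℝ) ≤ (c : ℝ) ^ θ := Real.rpow_nonneg hc0.le _
  have ha_le : (a : ℝ) ≤ 2 * (c : ℝ) ^ θ := le_trans (le_mul_of_one_le_right (by positivity) hE1) haE
  have hE_le : (E : ℝ) ≤ 2 * (c : ℝ) ^ θ := le_trans (le_mul_of_one_le_left (by positivity) ha1) haE
  -- `B = 8 c^{3θ}` dominates `a`, `v`, `w`
  set B : ℝ := 8 * (c : ℝ) ^ (3 * θ) with hB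
  have hc3θ0 : (0 : ℝ) ≤ (c : ℝ) ^ (3 * θ) := Real.rpow_nonneg hc0.le _
  have hB0 : 0 < B := mul_pos (by norm_num) (Real.rpow_pos_of_pos hc0 _)
  have hB3 : (2 * (c : ℝ) ^ θ) ^ 3 = B := by
    have h : ((c : ℝ) ^ θ) ^ 3 = (c : ℝ) ^ (3 * θ) := by
      rw [← Real.rpow_natCast, ← Real.rpow_mul hc0.le]; congr 1; push_cast; ring
    rw [mul_pow, h, hB]; norm_num
  have haB : (a : ℝ) ≤ B := by
    have h : (c : ℝ) ^ θ ≤ (c : ℝ) ^ (3 * θ) := Real.rpow_le_rpow_of_exponent_le hc1 (by linarith)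
    rw [hB]; linarith
  have hEB : (E : ℝ) ^ 3 ≤ B := by
    rw [← hB3]; exact pow_le_pow_left₀ (by positivity) hE_le 3
  have hvB : (v : ℝ) ≤ B := le_trans (by exact_mod_cast hvE) hEB
  have hwB : (w : ℝ) ≤ B := le_trans (by exact_mod_cast hwE) hEB
  -- `B ≤ 8 √c` and `B^{4/η+1} = 8^{4/η+1} √c`
  have h3θ : 3 * θ ≤ 1 / 2 := by
    rw [hθ, ← mul_div_assoc, div_le_iff₀ (by positivity)]; linarith
  have hBsqrt : B ≤ 8 * Real.sqrt c := by
    rw [hB, Real.sqrt_eq_rpow]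
    exact mul_le_mul_of_nonneg_left (Real.rpow_le_rpow_of_exponent_le hc1 h3θ) (by norm_num)
  have hBpow : B ^ (4 / η + 1) = (8 : ℝ) ^ (4 / η + 1) * Real.sqrt c := by
    rw [hB, Real.mul_rpow (by norm_num) hc3θ0, ← Real.rpow_mul hc0.le, Real.sqrt_eq_rpow]
    congr 2
    rw [hθ]; field_simp; ring
  -- the threshold `K²`, `K = 8^{4/η+1} + 8 Z₀⁴`
  set K : ℝ := (8 : ℝ) ^ (4 / η + 1) + 8 * (Z₀ : ℝ) ^ 4 with hK
  have hK8 : (0 : ℝ) ≤ (8 : ℝ) ^ (4 / η + 1) := by positivity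
  have hKZ : (0 : ℝ) ≤ 8 * (Z₀ : ℝ) ^ 4 := by positivity
  have hK0 : 0 ≤ K := by rw [hK]; positivity
  by_contra hcon
  rw [not_lt] at hcon
  have hsqrt : K ≤ Real.sqrt c := by
    have h := Real.sqrt_le_sqrt hcon
    rwa [Real.sqrt_sq hK0] at h
  have hsc0 : 0 ≤ Real.sqrt c := Real.sqrt_nonneg _
  have hsc : 0 < Real.sqrt c := Real.sqrt_pos.mpr hc0
  have hKc : K * Real.sqrt c ≤ c :=
    calc K * Real.sqrt c ≤ Real.sqrt c * Real.sqrt c := mul_le_mul_of_nonneg_right hsqrt hsc0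
      _ = c := Real.mul_self_sqrt hc0.le
  have hcBZ : (c : ℝ) ≤ B * (Z : ℝ) ^ 4 :=
    calc (c : ℝ) = (w : ℝ) * (Z : ℝ) ^ 4 := by rw [hc]; push_cast; ring
      _ ≤ B * (Z : ℝ) ^ 4 := mul_le_mul_of_nonneg_right hwB (by positivity)
  -- (i) `Z ≥ Z₀`
  have hZ : Z₀ ≤ Z := by
    by_contra hlt
    rw [not_le] at hlt
    have h1 : (Z : ℝ) ^ 4 < (Z₀ : ℝ) ^ 4 := by exact_mod_cast Nat.pow_lt_pow_left hlt (by norm_num)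
    have h2 : B * (Z : ℝ) ^ 4 ≤ 8 * Real.sqrt c * (Z : ℝ) ^ 4 :=
      mul_le_mul_of_nonneg_right hBsqrt (by positivity)
    have h3 : 8 * Real.sqrt c * (Z : ℝ) ^ 4 < 8 * Real.sqrt c * (Z₀ : ℝ) ^ 4 :=
      mul_lt_mul_of_pos_left h1 (by positivity)
    have h4 : 8 * Real.sqrt c * (Z₀ : ℝ) ^ 4 ≤ K * Real.sqrt c :=
      calc 8 * Real.sqrt c * (Z₀ : ℝ) ^ 4 = (8 * (Z₀ : ℝ) ^ 4) * Real.sqrt c := by ring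
        _ ≤ K * Real.sqrt c := mul_le_mul_of_nonneg_right (by rw [hK]; linarith) hsc0
    linarith
  -- (ii) `B ≤ Z^η`
  have hBZ : B ≤ (Z : ℝ) ^ η := by
    have h1 : B * B ^ (4 / η) ≤ B * (Z : ℝ) ^ 4 :=
      calc B * B ^ (4 / η) = B ^ (4 / η + 1) := by rw [Real.rpow_add hB0, Real.rpow_one, mul_comm]
        _ = (8 : ℝ) ^ (4 / η + 1) * Real.sqrt c := hBpow
        _ ≤ K * Real.sqrt c := mul_le_mul_of_nonneg_right (by rw [hK]; linarith) hsc0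
        _ ≤ c := hKc
        _ ≤ B * (Z : ℝ) ^ 4 := hcBZ
    have h2 : B ^ (4 / η) ≤ (Z : ℝ) ^ 4 := le_of_mul_le_mul_left h1 hB0
    have h3 : (B ^ (4 / η)) ^ (η / 4) ≤ ((Z : ℝ) ^ 4) ^ (η / 4) :=
      Real.rpow_le_rpow (by positivity) h2 (by positivity)
    have h4 : (B ^ (4 / η)) ^ (η / 4) = B := by
      rw [← Real.rpow_mul hB0.le, show 4 / η * (η / 4) = 1 by field_simp, Real.rpow_one]
    have h5 : ((Z : ℝ) ^ 4) ^ (η / 4) = (Z : ℝ) ^ η := by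
      rw [← Real.rpow_natCast, ← Real.rpow_mul (Nat.cast_nonneg Z)]; congr 1; push_cast; ring
    rwa [h4, h5] at h3
  -- (iii) feed the saving
  have hmax : ((max v w : ℕ) : ℝ) ≤ (Z : ℝ) ^ η := by
    rw [Nat.cast_max]; exact max_le (hvB.trans hBZ) (hwB.trans hBZ)
  have hcop' : Nat.Coprime (v * Y) (w * Z) := by
    have hbc : Nat.Coprime b c := by rw [← heq]; exact Nat.coprime_add_self_right.mpr hcop.symm
    rw [hb, hc] at hbc
    exact Nat.Coprime.coprime_dvd_right ⟨Z ^ 3, by ring⟩ (Nat.Coprime.coprime_dvd_left ⟨Y ^ 3, by ring⟩ hbc)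
  have hne : w * Z ^ 4 ≠ v * Y ^ 4 := by rw [← hb, ← hc]; omega
  have key := hU v w Y Z hZ hv0 hw0 hY0 hcop' hmax hne
  have habs : |((w * Z ^ 4 : ℕ) : ℝ) - ((v * Y ^ 4 : ℕ) : ℝ)| = (a : ℝ) := by
    have h : ((w * Z ^ 4 : ℕ) : ℝ) - ((v * Y ^ 4 : ℕ) : ℝ) = (a : ℝ) := by
      rw [← hb, ← hc, ← heq]; push_cast; ring
    rw [h]; exact abs_of_nonneg (Nat.cast_nonneg a)
  rw [habs] at key
  linarith

/-- **A violator with `a ≤ b` has bounded `c`.** For `s ≥ 4/(2 + η/(24+6η))`, a positive coprime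
tower point with `a ≤ b` and `Π^s ≤ c` has `c < (8^{4/η+1} + 8Z₀⁴)²` (the tower data fed into
`stubTransfer_core` via `Negative.bad_point_shape` and `Fin.prod_univ_four`). -/
theorem stubTransfer_violator_lt {η : ℝ} (hη : 0 < η) {Z₀ : ℕ}
    (hU : ∀ v w Y Z : ℕ, Z₀ ≤ Z → 0 < v → 0 < w → 0 < Y → Nat.Coprime (v * Y) (w * Z) →
      ((max v w : ℕ) : ℝ) ≤ (Z : ℝ) ^ η → w * Z ^ 4 ≠ v * Y ^ 4 →
      (Z : ℝ) ^ η < |((w * Z ^ 4 : ℕ) : ℝ) - ((v * Y ^ 4 : ℕ) : ℝ)|)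
    {s : ℝ} (hs : 4 / (2 + η / (24 + 6 * η)) ≤ s) (x y z : Fin 4 → ℕ)
    (hpos : ∀ i, 0 < x i ∧ 0 < y i ∧ 0 < z i)
    (heq : (∏ i, x i ^ (i.val + 1)) + (∏ i, y i ^ (i.val + 1)) = ∏ i, z i ^ (i.val + 1))
    (hcop : Nat.Coprime (∏ i, x i ^ (i.val + 1)) (∏ i, y i ^ (i.val + 1)))
    (hab : (∏ i, x i ^ (i.val + 1)) ≤ (∏ i, y i ^ (i.val + 1)))
    (hbad : ((∏ i, x i * y i * z i : ℕ) : ℝ) ^ s ≤ ((∏ i, z i ^ (i.val + 1) : ℕ) : ℝ)) :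
    ((∏ i, z i ^ (i.val + 1) : ℕ) : ℝ) < ((8 : ℝ) ^ (4 / η + 1) + 8 * (Z₀ : ℝ) ^ 4) ^ 2 := by
  have hs0 : 0 < s := lt_of_lt_of_le (by positivity) hs
  have hshape := Negative.bad_point_shape (C := 1) one_pos hs0 x y z hpos heq (by rwa [one_mul])
  rw [min_eq_left hab, div_one] at hshape
  have ha0 : 0 < ∏ i, x i ^ (i.val + 1) := Finset.prod_pos fun i _ => pow_pos (hpos i).1 _
  have hb' : (∏ i, y i ^ (i.val + 1)) = (y 0 * y 1 ^ 2 * y 2 ^ 3) * y 3 ^ 4 := by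
    simp only [Fin.prod_univ_four, Fin.isValue, Fin.val_zero, Fin.val_one, Fin.val_two]
    simp only [show (3 : Fin 4).val = 3 from rfl]
    ring
  have hc' : (∏ i, z i ^ (i.val + 1)) = (z 0 * z 1 ^ 2 * z 2 ^ 3) * z 3 ^ 4 := by
    simp only [Fin.prod_univ_four, Fin.isValue, Fin.val_zero, Fin.val_one, Fin.val_two]
    simp only [show (3 : Fin 4).val = 3 from rfl]
    ring
  obtain ⟨hx0, hy0, hz0⟩ := hpos 0
  obtain ⟨hx1, hy1, hz1⟩ := hpos 1
  obtain ⟨hx2, hy2, hz2⟩ := hpos 2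
  have hy3 : 0 < y 3 := (hpos 3).2.1
  have hE0 : 0 < (x 0 * y 0 * z 0) ^ 3 * (x 1 * y 1 * z 1) ^ 2 * (x 2 * y 2 * z 2) := by positivity
  have hvE : y 0 * y 1 ^ 2 * y 2 ^ 3 ≤ ((x 0 * y 0 * z 0) ^ 3 * (x 1 * y 1 * z 1) ^ 2 * (x 2 * y 2 * z 2)) ^ 3 :=
    Nat.le_of_dvd (pow_pos hE0 3)
      ⟨x 0 ^ 9 * z 0 ^ 9 * y 0 ^ 8 * (x 1 ^ 6 * z 1 ^ 6 * y 1 ^ 4) * (x 2 ^ 3 * z 2 ^ 3), by ring⟩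
  have hwE : z 0 * z 1 ^ 2 * z 2 ^ 3 ≤ ((x 0 * y 0 * z 0) ^ 3 * (x 1 * y 1 * z 1) ^ 2 * (x 2 * y 2 * z 2)) ^ 3 :=
    Nat.le_of_dvd (pow_pos hE0 3)
      ⟨x 0 ^ 9 * y 0 ^ 9 * z 0 ^ 8 * (x 1 ^ 6 * y 1 ^ 6 * z 1 ^ 4) * (x 2 ^ 3 * y 2 ^ 3), by ring⟩
  exact stubTransfer_core hη hU hs ha0 heq hcop hb' hc' (by positivity) (by positivity) hy3 hE0 hvE hwE
    hshape

/-- The mirror case `b ≤ a`: swap `x ↔ y` (the tower data is symmetric: `add_comm`,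
`Nat.Coprime.symm`, commutativity inside `∏ xᵢyᵢzᵢ`). -/
theorem stubTransfer_violator_lt' {η : ℝ} (hη : 0 < η) {Z₀ : ℕ}
    (hU : ∀ v w Y Z : ℕ, Z₀ ≤ Z → 0 < v → 0 < w → 0 < Y → Nat.Coprime (v * Y) (w * Z) →
      ((max v w : ℕ) : ℝ) ≤ (Z : ℝ) ^ η → w * Z ^ 4 ≠ v * Y ^ 4 →
      (Z : ℝ) ^ η < |((w * Z ^ 4 : ℕ) : ℝ) - ((v * Y ^ 4 : ℕ) : ℝ)|)
    {s : ℝ} (hs : 4 / (2 + η / (24 + 6 * η)) ≤ s) (x y z : Fin 4 → ℕ)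
    (hpos : ∀ i, 0 < x i ∧ 0 < y i ∧ 0 < z i)
    (heq : (∏ i, x i ^ (i.val + 1)) + (∏ i, y i ^ (i.val + 1)) = ∏ i, z i ^ (i.val + 1))
    (hcop : Nat.Coprime (∏ i, x i ^ (i.val + 1)) (∏ i, y i ^ (i.val + 1)))
    (hba : (∏ i, y i ^ (i.val + 1)) ≤ (∏ i, x i ^ (i.val + 1)))
    (hbad : ((∏ i, x i * y i * z i : ℕ) : ℝ) ^ s ≤ ((∏ i, z i ^ (i.val + 1) : ℕ) : ℝ)) :
    ((∏ i, z i ^ (i.val + 1) : ℕ) : ℝ) < ((8 : ℝ) ^ (4 / η + 1) + 8 * (Z₀ : ℝ) ^ 4) ^ 2 := by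
  have hP : (∏ i, y i * x i * z i) = ∏ i, x i * y i * z i :=
    Finset.prod_congr rfl fun i _ => by ring
  exact stubTransfer_violator_lt hη hU hs y x z (fun i => ⟨(hpos i).2.1, (hpos i).1, (hpos i).2.2⟩)
    (by rw [add_comm]; exact heq) hcop.symm hba (by rw [hP]; exact hbad)

/-- **Stub `stub_transfer` (registered form): the uniform binomial-quartic saving implies the crux.**
Some saving `η > 0` beyond some height `Z₀` gives `TowerFourSubLiouville` with `A = 4/(2 + η/(24+6η)) < 2`
and, for every `ε > 0`, the constant `C = (8^{4/η+1} + 8Z₀⁴)² + 1`. -/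
theorem stub_transfer : (∃ η : ℝ, 0 < η ∧ ∃ Z₀ : ℕ, ∀ v w Y Z : ℕ, Z₀ ≤ Z → 0 < v → 0 < w → 0 < Y → Nat.Coprime (v * Y) (w * Z) → ((max v w : ℕ) : ℝ) ≤ (Z : ℝ) ^ η → w * Z ^ 4 ≠ v * Y ^ 4 → (Z : ℝ) ^ η < |((w * Z ^ 4 : ℕ) : ℝ) - ((v * Y ^ 4 : ℕ) : ℝ)|) → Summit.ABC.ABC.Theses.IneffectiveSubspace.TowerFourSubLiouville := by
  rintro ⟨η, hη, Z₀, hU⟩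
  unfold Summit.ABC.ABC.Theses.IneffectiveSubspace.TowerFourSubLiouville
  have hθ0 : 0 < η / (24 + 6 * η) := by positivity
  refine ⟨4 / (2 + η / (24 + 6 * η)), ?_, fun ε hε => ?_⟩
  · rw [div_lt_iff₀ (by positivity)]; linarith
  have hM0 : (0 : ℝ) ≤ ((8 : ℝ) ^ (4 / η + 1) + 8 * (Z₀ : ℝ) ^ 4) ^ 2 := by positivity
  refine ⟨((8 : ℝ) ^ (4 / η + 1) + 8 * (Z₀ : ℝ) ^ 4) ^ 2 + 1, by positivity, fun x y z hpos heq hcop => ?_⟩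
  have hs : 4 / (2 + η / (24 + 6 * η)) ≤ 4 / (2 + η / (24 + 6 * η)) + ε := by linarith
  have hs0 : 0 < 4 / (2 + η / (24 + 6 * η)) + ε := by positivity
  have hP1 : (1 : ℝ) ≤ ((∏ i, x i * y i * z i : ℕ) : ℝ) := by
    exact_mod_cast Finset.prod_pos fun i _ =>
      Nat.mul_pos (Nat.mul_pos (hpos i).1 (hpos i).2.1) (hpos i).2.2
  have hPs : (1 : ℝ) ≤ ((∏ i, x i * y i * z i : ℕ) : ℝ) ^ (4 / (2 + η / (24 + 6 * η)) + ε) :=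
    Real.one_le_rpow hP1 hs0.le
  have hPs0 : (0 : ℝ) ≤ ((∏ i, x i * y i * z i : ℕ) : ℝ) ^ (4 / (2 + η / (24 + 6 * η)) + ε) := by
    linarith
  rcases lt_or_ge ((∏ i, z i ^ (i.val + 1) : ℕ) : ℝ)
      (((∏ i, x i * y i * z i : ℕ) : ℝ) ^ (4 / (2 + η / (24 + 6 * η)) + ε)) with hgood | hbad
  · exact lt_of_lt_of_le hgood (le_mul_of_one_le_left hPs0 (by linarith))
  · have hcM : ((∏ i, z i ^ (i.val + 1) : ℕ) : ℝ) < ((8 : ℝ) ^ (4 / η + 1) + 8 * (Z₀ : ℝ) ^ 4) ^ 2 := by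
      rcases le_total (∏ i, x i ^ (i.val + 1)) (∏ i, y i ^ (i.val + 1)) with hab | hba
      · exact stubTransfer_violator_lt hη hU hs x y z hpos heq hcop hab hbad
      · exact stubTransfer_violator_lt' hη hU hs x y z hpos heq hcop hba hbad
    calc ((∏ i, z i ^ (i.val + 1) : ℕ) : ℝ)
        < ((8 : ℝ) ^ (4 / η + 1) + 8 * (Z₀ : ℝ) ^ 4) ^ 2 := hcM
      _ ≤ ((8 : ℝ) ^ (4 / η + 1) + 8 * (Z₀ : ℝ) ^ 4) ^ 2 *
            ((∏ i, x i * y i * z i : ℕ) : ℝ) ^ (4 / (2 + η / (24 + 6 * η)) + ε) :=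
          le_mul_of_one_le_right hM0 hPs
      _ ≤ (((8 : ℝ) ^ (4 / η + 1) + 8 * (Z₀ : ℝ) ^ 4) ^ 2 + 1) *
            ((∏ i, x i * y i * z i : ℕ) : ℝ) ^ (4 / (2 + η / (24 + 6 * η)) + ε) :=
          mul_le_mul_of_nonneg_right (by linarith) hPs0

end Summit.ABC.ABC.Theorems.TowerFourSubLiouville
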